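import Mathlib
import HarnessLib
import Summits.NavierStokesRegularity.NavierStokesRegularity.Theorems.PoloidalWindowDoorPoloidalWindowRigiditySparseEnergyScaledPressure

/-!
# Route `PoloidalWindowDoor`, crux `PoloidalWindowRigidity` (stmt-19708), line `sparse_energy` — A CONSEQUENCE OF S1:
# THE CKN PRESSURE QUANTITY `D(R) = R⁻² ∫∫_{Q_R} |q − c(t)|^{3/2}` OF A TYPE-I PROFILE IS BOUNDED AT EVERY CYLINDER, UP TO THE APEX

Seat ns-poloidal-K2-p2 g10 (LEAD-lineage on 19708; file `--supports`).  Hölder-type packaging of the scale-invariant pressure split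
`…SparseEnergyScaledPressure.scaledPressure_split` (`q(t) = c + p₁ + r`, `∫_{B̄(a,2R)} p₁² ≤ A·R/(−t)`, `|r| ≤ B/R²`): per slice, with
`λ = √R · (−t)^{1/4}` (Young `y³ ≤ ¾λy⁴ + ¼λ⁻³`, `y = √|p₁|`) and `(α²+β²)^{3/2} ≤ √2(α³+β³)`,

  `∫_{B_R(a)} |q(t) − c|^{3/2} ≤ √2·((¾A + ¼|B₁|)·R^{3/2}(−t)^{−3/4} + B^{3/2}|B₁|)`,

and `∫_{t₀−R²}^{t₀} (−t)^{−3/4} dt ≤ 4√R`, whence `∫∫_{Q_R(a,t₀)} |q − c(t)|^{3/2} ≤ D₀·R²` for every `t₀ ≤ 0` (apex time included, by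
`setLIntegral_iUnion_of_directed`), `D₀ = √2(3A + |B₁| + B^{3/2}|B₁|)`.  The power `|·|^{3/2}` is written `(√|·|)³` (no `rpow`).
With S1 (`A, E`) and `…ScaledCubic` (`C`): every profile of the Type-I class is «Type I in all four CKN scaled quantities» at every scale,
centre and apex time `t₀ ≤ 0`.

WHAT THIS IS NOT: not a claim about Navier–Stokes regularity; an a-priori estimate for hypothetical Type-I ancient profiles (bears_on LADDER-NS N0
via crux 19708, line sparse_energy). [folklore]
-/

noncomputable section

-- the summit and its single sub-problem share the name (CONVENTIONS §1), as in every Theorems file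
set_option linter.dupNamespace false

namespace Summit.NavierStokesRegularity.NavierStokesRegularity.Theorems.PoloidalWindowDoorPoloidalWindowRigiditySparseEnergyScaledPressureD

open MeasureTheory Set Function Filter Topology Metric intervalIntegral
open scoped ENNReal
open Literature.Analysis Literature.Analysis.FluidPDE
open Summit.NavierStokesRegularity.NavierStokesRegularity.Theorems.PoloidalWindowDoorPoloidalWindowRigiditySparseEnergyScaledPressure

variable {C : ℝ} {v : ℝ → EuclideanSpace ℝ (Fin 3) → EuclideanSpace ℝ (Fin 3)}

/-! ### Two polynomial inequalities -/

/-- **Young**: `y³ ≤ ¾·λ·y⁴ + ¼·λ⁻³` for `y ≥ 0`, `λ > 0` (`3z⁴ − 4z³ + 1 = (z−1)²(3z²+2z+1) ≥ 0`, `z = λy`). [folklore] -/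
theorem cube_le_young {y l : ℝ} (hy : 0 ≤ y) (hl : 0 < l) : y ^ 3 ≤ 3 / 4 * l * y ^ 4 + 1 / 4 * l⁻¹ ^ 3 := by
  have hl3 : 0 < l ^ 3 := pow_pos hl 3
  have key : 4 * (l * y) ^ 3 ≤ 3 * (l * y) ^ 4 + 1 := by
    nlinarith [mul_nonneg (sq_nonneg (l * y - 1)) (by positivity : (0 : ℝ) ≤ 3 * (l * y) ^ 2 + 2 * (l * y) + 1),
      mul_nonneg hl.le hy]
  rw [inv_pow]
  have h2 : y ^ 3 * (4 * l ^ 3) ≤ (3 / 4 * l * y ^ 4 + 1 / 4 * (l ^ 3)⁻¹) * (4 * l ^ 3) := by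
    have e1 : y ^ 3 * (4 * l ^ 3) = 4 * (l * y) ^ 3 := by ring
    have e2 : (3 / 4 * l * y ^ 4 + 1 / 4 * (l ^ 3)⁻¹) * (4 * l ^ 3) = 3 * (l * y) ^ 4 + 1 := by
      field_simp
      try ring
    rw [e1, e2]; exact key
  exact le_of_mul_le_mul_right h2 (by positivity)

/-- `(√(α² + β²))³ ≤ √2·(α³ + β³)` for `α, β ≥ 0` (`(α²+β²)³ ≤ 2(α³+β³)²`, i.e. `(α−β)²(α⁴+2α³β+2αβ³+β⁴) ≥ 0`). [folklore] -/
theorem sqrt_sq_add_sq_cube_le {α β : ℝ} (hα : 0 ≤ α) (hβ : 0 ≤ β) :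
    Real.sqrt (α ^ 2 + β ^ 2) ^ 3 ≤ Real.sqrt 2 * (α ^ 3 + β ^ 3) := by
  have hL0 : 0 ≤ Real.sqrt (α ^ 2 + β ^ 2) ^ 3 := by positivity
  have hR0 : 0 ≤ Real.sqrt 2 * (α ^ 3 + β ^ 3) := by positivity
  rw [← abs_of_nonneg hL0, ← abs_of_nonneg hR0, ← sq_le_sq]
  have e1 : (Real.sqrt (α ^ 2 + β ^ 2) ^ 3) ^ 2 = (α ^ 2 + β ^ 2) ^ 3 := by
    rw [← pow_mul, show 3 * 2 = 2 * 3 by norm_num, pow_mul, Real.sq_sqrt (by positivity)]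
  have e2 : (Real.sqrt 2 * (α ^ 3 + β ^ 3)) ^ 2 = 2 * (α ^ 3 + β ^ 3) ^ 2 := by
    rw [mul_pow, Real.sq_sqrt (by norm_num)]
  rw [e1, e2]
  nlinarith [mul_nonneg (sq_nonneg (α - β)) (by positivity : (0 : ℝ) ≤ α ^ 4 + 2 * α ^ 3 * β + 2 * α * β ^ 3 + β ^ 4)]

/-- Pointwise: `(√X)³ ≤ √2·(¾λY² + ¼λ⁻³ + (√b)³)` whenever `0 ≤ X ≤ |Y| + b`, `b ≥ 0`, `λ > 0`. [folklore] -/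
theorem sqrt_cube_le_of_le_abs_add {X Y b l : ℝ} (hX : X ≤ |Y| + b) (hb : 0 ≤ b) (hl : 0 < l) :
    Real.sqrt X ^ 3 ≤ Real.sqrt 2 * (3 / 4 * l * Y ^ 2 + 1 / 4 * l⁻¹ ^ 3 + Real.sqrt b ^ 3) := by
  have h1 : Real.sqrt X ^ 3 ≤ Real.sqrt (|Y| + b) ^ 3 := pow_le_pow_left₀ (Real.sqrt_nonneg _) (Real.sqrt_le_sqrt hX) 3
  have h2 : Real.sqrt (|Y| + b) ^ 3 ≤ Real.sqrt 2 * (Real.sqrt |Y| ^ 3 + Real.sqrt b ^ 3) := by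
    have := sqrt_sq_add_sq_cube_le (Real.sqrt_nonneg |Y|) (Real.sqrt_nonneg b)
    rwa [Real.sq_sqrt (abs_nonneg Y), Real.sq_sqrt hb] at this
  have h3 : Real.sqrt |Y| ^ 3 ≤ 3 / 4 * l * Y ^ 2 + 1 / 4 * l⁻¹ ^ 3 := by
    have := cube_le_young (Real.sqrt_nonneg |Y|) hl
    have e : Real.sqrt |Y| ^ 4 = Y ^ 2 := by
      rw [show (4 : ℕ) = 2 * 2 by norm_num, pow_mul, Real.sq_sqrt (abs_nonneg Y), sq_abs]
    rwa [e] at this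
  have hs2 : 0 ≤ Real.sqrt 2 := Real.sqrt_nonneg 2
  calc Real.sqrt X ^ 3 ≤ Real.sqrt (|Y| + b) ^ 3 := h1
    _ ≤ Real.sqrt 2 * (Real.sqrt |Y| ^ 3 + Real.sqrt b ^ 3) := h2
    _ ≤ Real.sqrt 2 * (3 / 4 * l * Y ^ 2 + 1 / 4 * l⁻¹ ^ 3 + Real.sqrt b ^ 3) :=
        mul_le_mul_of_nonneg_left (by linarith [h3]) hs2

/-! ### The time weight `(−t)^{−3/4} = 1/(√(−t)·√(√(−t)))` -/

/-- `d/dt (−4√(√(−t))) = 1/(√(−t)·√(√(−t)))` for `t < 0`. [folklore] -/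
theorem hasDerivAt_neg_four_sqrt_sqrt {t : ℝ} (ht : t < 0) :
    HasDerivAt (fun τ : ℝ => -4 * Real.sqrt (Real.sqrt (-τ))) (1 / (Real.sqrt (-t) * Real.sqrt (Real.sqrt (-t)))) t := by
  have hnt : 0 < -t := neg_pos.2 ht
  have hs : 0 < Real.sqrt (-t) := Real.sqrt_pos.2 hnt
  have h1 : HasDerivAt (fun τ : ℝ => Real.sqrt (-τ)) (1 / (2 * Real.sqrt (-t)) * (-1)) t :=
    (Real.hasDerivAt_sqrt hnt.ne').comp t (hasDerivAt_neg t)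
  have h2 : HasDerivAt (fun τ : ℝ => Real.sqrt (Real.sqrt (-τ)))
      (1 / (2 * Real.sqrt (Real.sqrt (-t))) * (1 / (2 * Real.sqrt (-t)) * (-1))) t :=
    (Real.hasDerivAt_sqrt hs.ne').comp t h1
  refine (h2.const_mul (-4)).congr_deriv ?_
  have hss : 0 < Real.sqrt (Real.sqrt (-t)) := Real.sqrt_pos.2 hs
  field_simp
  ring

/-- **`∫_s^{t₁} dt/(√(−t)·√(√(−t))) = 4(√(√(−s)) − √(√(−t₁)))`** for `s < t₁ < 0`. [folklore] -/
theorem integral_timeWeight_threeQuarter {s t₁ : ℝ} (hst : s < t₁) (ht₁ : t₁ < 0) :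
    ∫ t in s..t₁, 1 / (Real.sqrt (-t) * Real.sqrt (Real.sqrt (-t))) =
      4 * (Real.sqrt (Real.sqrt (-s)) - Real.sqrt (Real.sqrt (-t₁))) := by
  have hderiv : ∀ t ∈ uIcc s t₁, HasDerivAt (fun τ : ℝ => -4 * Real.sqrt (Real.sqrt (-τ)))
      (1 / (Real.sqrt (-t) * Real.sqrt (Real.sqrt (-t)))) t := by
    intro t ht; rw [uIcc_of_le hst.le] at ht; exact hasDerivAt_neg_four_sqrt_sqrt (lt_of_le_of_lt ht.2 ht₁)
  have hcont : ContinuousOn (fun t : ℝ => 1 / (Real.sqrt (-t) * Real.sqrt (Real.sqrt (-t)))) (uIcc s t₁) := by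
    rw [uIcc_of_le hst.le]
    refine continuousOn_const.div (continuousOn_id.neg.sqrt.mul continuousOn_id.neg.sqrt.sqrt) fun t ht => ?_
    have hnt : 0 < -t := neg_pos.2 (lt_of_le_of_lt ht.2 ht₁)
    exact (mul_pos (Real.sqrt_pos.2 hnt) (Real.sqrt_pos.2 (Real.sqrt_pos.2 hnt))).ne'
  rw [integral_eq_sub_of_hasDerivAt hderiv hcont.intervalIntegrable]
  ring

/-- `√(√(R² + u)) − √(√u) ≤ √R` for `R, u ≥ 0`. [folklore] -/
theorem sqrt_sqrt_sq_add_sub_le {R u : ℝ} (hR : 0 ≤ R) (hu : 0 ≤ u) :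
    Real.sqrt (Real.sqrt (R ^ 2 + u)) - Real.sqrt (Real.sqrt u) ≤ Real.sqrt R := by
  have h1 : Real.sqrt (R ^ 2 + u) ≤ R + Real.sqrt u := by
    rw [Real.sqrt_le_left (by positivity)]
    nlinarith [Real.sq_sqrt hu, Real.sqrt_nonneg u]
  have h2 : Real.sqrt (Real.sqrt (R ^ 2 + u)) ≤ Real.sqrt (R + Real.sqrt u) := Real.sqrt_le_sqrt h1
  have h3 : Real.sqrt (R + Real.sqrt u) ≤ Real.sqrt R + Real.sqrt (Real.sqrt u) := by
    rw [Real.sqrt_le_left (by positivity)]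
    nlinarith [Real.sq_sqrt hR, Real.sq_sqrt (Real.sqrt_nonneg u), Real.sqrt_nonneg R, Real.sqrt_nonneg (Real.sqrt u)]
  linarith

/-! ### The slice bound -/

/-- **The slice bound.**  If on `B̄(a,2R)` the slice pressure is `q = c + p₁ + r` with `∫_{B̄(a,2R)} p₁² ≤ A·R/(−t)` and `|r| ≤ B/R²`,
then `∫⁻_{B_R(a)} (√|q − c|)³ ≤ √2·((¾A + ¼|B₁|)·R√R/(√(−t)√(√(−t))) + B√B·|B₁|)` (`|B₁|` the volume of the unit ball). [folklore] -/
theorem slice_threeHalves_le {q p₁ : EuclideanSpace ℝ (Fin 3) → ℝ} (hp₁ : Continuous p₁) {t R A B c : ℝ}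
    (ht : t < 0) (hR : 0 < R) (hB : 0 ≤ B) {a : EuclideanSpace ℝ (Fin 3)}
    (hL2 : ∫ x in closedBall a (2 * R), p₁ x ^ 2 ≤ A * R / (-t))
    (hr : ∀ x ∈ closedBall a (2 * R), |q x - c - p₁ x| ≤ B / R ^ 2) :
    (∫⁻ x in ball a R, ENNReal.ofReal (Real.sqrt |q x - c| ^ 3)) ≤
      ENNReal.ofReal (Real.sqrt 2 * ((3 / 4 * A + 1 / 4 * (volume : Measure (EuclideanSpace ℝ (Fin 3))).real (ball 0 1)) *
        (R * Real.sqrt R / (Real.sqrt (-t) * Real.sqrt (Real.sqrt (-t)))) +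
        B * Real.sqrt B * (volume : Measure (EuclideanSpace ℝ (Fin 3))).real (ball 0 1))) := by
  set V₁ : ℝ := (volume : Measure (EuclideanSpace ℝ (Fin 3))).real (ball 0 1) with hV₁
  have hV₁0 : 0 ≤ V₁ := measureReal_nonneg
  have hnt : 0 < -t := neg_pos.2 ht
  set σ : ℝ := Real.sqrt (Real.sqrt (-t)) with hσ
  have hs0 : 0 < Real.sqrt (-t) := Real.sqrt_pos.2 hnt
  have hσ0 : 0 < σ := Real.sqrt_pos.2 hs0
  have hσ2 : σ ^ 2 = Real.sqrt (-t) := Real.sq_sqrt hs0.le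
  have hσ4 : σ ^ 4 = -t := by rw [show (4 : ℕ) = 2 * 2 by norm_num, pow_mul, hσ2, Real.sq_sqrt hnt.le]
  have hsR : Real.sqrt R ^ 2 = R := Real.sq_sqrt hR.le
  have hsR0 : 0 < Real.sqrt R := Real.sqrt_pos.2 hR
  -- the Young parameter
  set l : ℝ := Real.sqrt R * σ with hl
  have hl0 : 0 < l := mul_pos hsR0 hσ0
  set b : ℝ := B / R ^ 2 with hb
  have hb0 : 0 ≤ b := by positivity
  -- the majorant and its integral over the ball
  set m : EuclideanSpace ℝ (Fin 3) → ℝ := fun x => Real.sqrt 2 * (3 / 4 * l * p₁ x ^ 2 + 1 / 4 * l⁻¹ ^ 3 + Real.sqrt b ^ 3) with hm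
  have hmc : Continuous m := by
    rw [hm]; exact continuous_const.mul ((continuous_const.mul (hp₁.pow 2)).add continuous_const |>.add continuous_const)
  have hm0 : ∀ x, 0 ≤ m x := fun x => by rw [hm]; positivity
  have hmi : IntegrableOn m (ball a R) := (hmc.continuousOn.integrableOn_compact (isCompact_closedBall a R)).mono_set ball_subset_closedBall
  have hpt : ∀ x ∈ ball a R, ENNReal.ofReal (Real.sqrt |q x - c| ^ 3) ≤ ENNReal.ofReal (m x) := by
    intro x hx
    refine ENNReal.ofReal_le_ofReal ?_
    have hx' : x ∈ closedBall a (2 * R) := by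
      rw [mem_closedBall]; rw [mem_ball] at hx; linarith
    have hX : |q x - c| ≤ |p₁ x| + b := by
      have h := hr x hx'
      have e : q x - c = p₁ x + (q x - c - p₁ x) := by ring
      rw [e]
      exact (abs_add_le _ _).trans (by linarith)
    exact sqrt_cube_le_of_le_abs_add hX hb0 hl0
  have hvol : (volume : Measure (EuclideanSpace ℝ (Fin 3))).real (ball a R) = R ^ 3 * V₁ := by
    rw [measureReal_def, Measure.addHaar_ball volume a hR.le, finrank_euclideanSpace_fin, ENNReal.toReal_mul,
      ENNReal.toReal_ofReal (by positivity), hV₁, measureReal_def]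
  have hp2i : IntegrableOn (fun x => p₁ x ^ 2) (ball a R) :=
    ((hp₁.pow 2).continuousOn.integrableOn_compact (isCompact_closedBall a R)).mono_set ball_subset_closedBall
  have hp2i' : IntegrableOn (fun x => p₁ x ^ 2) (closedBall a (2 * R)) :=
    (hp₁.pow 2).continuousOn.integrableOn_compact (isCompact_closedBall a (2 * R))
  have hball : ∫ x in ball a R, p₁ x ^ 2 ≤ A * R / (-t) := by
    refine le_trans ?_ hL2
    exact setIntegral_mono_set hp2i' (ae_of_all _ fun x => sq_nonneg _)
      (ae_of_all _ (ball_subset_closedBall.trans (closedBall_subset_closedBall (by linarith))))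
  have hint_m : ∫ x in ball a R, m x = Real.sqrt 2 * (3 / 4 * l * ∫ x in ball a R, p₁ x ^ 2) +
      Real.sqrt 2 * (1 / 4 * l⁻¹ ^ 3 + Real.sqrt b ^ 3) * (R ^ 3 * V₁) := by
    rw [hm]
    simp only
    rw [MeasureTheory.integral_const_mul]
    have e : (fun x => 3 / 4 * l * p₁ x ^ 2 + 1 / 4 * l⁻¹ ^ 3 + Real.sqrt b ^ 3) =
        fun x => 3 / 4 * l * p₁ x ^ 2 + (1 / 4 * l⁻¹ ^ 3 + Real.sqrt b ^ 3) := by funext x; ring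
    have hci : IntegrableOn (fun _ : EuclideanSpace ℝ (Fin 3) => 1 / 4 * l⁻¹ ^ 3 + Real.sqrt b ^ 3) (ball a R) :=
      (continuousOn_const.integrableOn_compact (isCompact_closedBall a R)).mono_set ball_subset_closedBall
    rw [e, MeasureTheory.integral_add (hp2i.const_mul _) hci,
      MeasureTheory.integral_const_mul, setIntegral_const, smul_eq_mul, hvol]
    ring
  -- the algebra of the Young parameter: `l·R/(−t) = R√R/σ³ = R³/l³`
  have halg : ∀ ρ : ℝ, 0 < ρ →
      (ρ * σ) * (A * ρ ^ 2 / σ ^ 4) = A * (ρ ^ 2 * ρ / (σ ^ 2 * σ)) ∧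
      (ρ * σ)⁻¹ ^ 3 * ((ρ ^ 2) ^ 3 * V₁) = V₁ * (ρ ^ 2 * ρ / (σ ^ 2 * σ)) := by
    intro ρ hρ
    constructor
    · field_simp
    · rw [inv_pow]
      field_simp
  have e1 : l * (A * R / (-t)) = A * (R * Real.sqrt R / (Real.sqrt (-t) * σ)) := by
    have h := (halg (Real.sqrt R) hsR0).1
    rw [hsR] at h
    rw [hl, ← hσ2, ← hσ4]
    exact h
  have e2 : l⁻¹ ^ 3 * (R ^ 3 * V₁) = V₁ * (R * Real.sqrt R / (Real.sqrt (-t) * σ)) := by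
    have h := (halg (Real.sqrt R) hsR0).2
    rw [hsR] at h
    rw [hl, ← hσ2]
    exact h
  have e3 : Real.sqrt b ^ 3 * (R ^ 3 * V₁) = B * Real.sqrt B * V₁ := by
    have hsb : Real.sqrt b = Real.sqrt B / R := by
      rw [hb, Real.sqrt_div' B (by positivity : 0 ≤ R ^ 2), Real.sqrt_sq hR.le]
    rw [hsb, div_pow]
    have hB3 : Real.sqrt B ^ 3 = B * Real.sqrt B := by
      rw [pow_succ, Real.sq_sqrt hB]
    rw [hB3]
    field_simp
  calc (∫⁻ x in ball a R, ENNReal.ofReal (Real.sqrt |q x - c| ^ 3))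
      ≤ ∫⁻ x in ball a R, ENNReal.ofReal (m x) := setLIntegral_mono' measurableSet_ball hpt
    _ = ENNReal.ofReal (∫ x in ball a R, m x) :=
        (ofReal_integral_eq_lintegral_ofReal hmi (ae_of_all _ hm0)).symm
    _ ≤ _ := by
        refine ENNReal.ofReal_le_ofReal ?_
        rw [hint_m]
        have hs2 : 0 ≤ Real.sqrt 2 := Real.sqrt_nonneg 2
        have hkey : 3 / 4 * l * (∫ x in ball a R, p₁ x ^ 2) ≤ 3 / 4 * l * (A * R / (-t)) :=
          mul_le_mul_of_nonneg_left hball (by positivity)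
        have hk2 : 3 / 4 * l * (A * R / (-t)) = 3 / 4 * (A * (R * Real.sqrt R / (Real.sqrt (-t) * σ))) := by
          rw [mul_assoc, e1]
        have hrest : Real.sqrt 2 * (1 / 4 * l⁻¹ ^ 3 + Real.sqrt b ^ 3) * (R ^ 3 * V₁) =
            Real.sqrt 2 * (1 / 4 * (V₁ * (R * Real.sqrt R / (Real.sqrt (-t) * σ))) + B * Real.sqrt B * V₁) := by
          rw [← e2, ← e3]; ring
        rw [hrest]
        nlinarith [hkey, hk2, hs2, mul_le_mul_of_nonneg_left (hkey.trans hk2.le) hs2]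

/-! ### The scaled pressure quantity `D` -/

/-- **THE CKN PRESSURE QUANTITY IS BOUNDED AT EVERY CYLINDER, UP TO THE APEX.**  For a profile of the route's Type-I class there is `D₀ ≥ 0`
such that for every window `(T,0)` its classical pressure `q` satisfies: for every `t₀ ≤ 0`, centre `a`, radius `R > 0` with
`T ≤ t₀ − R²`, there are constants `c(t)` with `∫⁻_{t₀−R²<t<t₀} ∫⁻_{B_R(a)} (√|q(t,x) − c(t)|)³ dx dt ≤ D₀·R²` (`(√|·|)³ = |·|^{3/2}`;
`D₀ = √2(3A + |B₁| + B√B|B₁|)` from `scaledPressure_split`). [folklore] -/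
theorem scaledPressure_threeHalves (hrate : HasTypeITimeDecay C v)
    (hcont : ContinuousOn (uncurry v) (Iio (0 : ℝ) ×ˢ univ))
    (hmild : ∀ s t : ℝ, s < t → t < 0 → ∀ x,
      v t x = UnboundedOperators.heatExtension (v s) (t - s) x - oseenDuhamel 1 s v v t x)
    (hdiv : ∀ t < 0, VectorCalculus.IsDivFree (v t)) :
    ∃ D₀ : ℝ, 0 ≤ D₀ ∧ ∀ T : ℝ, T < 0 → ∃ q : ℝ → EuclideanSpace ℝ (Fin 3) → ℝ,
      IsClassicalNSSolutionOn (Ioo T 0) 1 0 v q ∧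
      ∀ t₀ : ℝ, t₀ ≤ 0 → ∀ (a : EuclideanSpace ℝ (Fin 3)) (R : ℝ), 0 < R → T ≤ t₀ - R ^ 2 →
        ∃ c : ℝ → ℝ, (∫⁻ t in Ioo (t₀ - R ^ 2) t₀, ∫⁻ x in ball a R, ENNReal.ofReal (Real.sqrt |q t x - c t| ^ 3)) ≤
          ENNReal.ofReal (D₀ * R ^ 2) := by
  obtain ⟨A, B, hA, hB, hsplit⟩ := scaledPressure_split hrate hcont hmild hdiv
  set V₁ : ℝ := (volume : Measure (EuclideanSpace ℝ (Fin 3))).real (ball 0 1) with hV₁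
  have hV₁0 : 0 ≤ V₁ := measureReal_nonneg
  set α : ℝ := Real.sqrt 2 * (3 / 4 * A + 1 / 4 * V₁) with hα
  set β : ℝ := Real.sqrt 2 * (B * Real.sqrt B * V₁) with hβ
  have hα0 : 0 ≤ α := by positivity
  have hβ0 : 0 ≤ β := by positivity
  refine ⟨4 * α + β, by positivity, fun T hT => ?_⟩
  obtain ⟨q, hcl, hwin⟩ := hsplit T hT
  refine ⟨q, hcl, fun t₀ ht₀ a R hR hTR => ?_⟩
  -- choose the constants `c(t)` on the window
  have hch : ∀ t : ℝ, ∃ (c : ℝ) (p₁ : EuclideanSpace ℝ (Fin 3) → ℝ), t ∈ Ioo T 0 → (Continuous p₁ ∧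
      (∫ x in closedBall a (2 * R), p₁ x ^ 2) ≤ A * R / (-t) ∧ ∀ x ∈ closedBall a (2 * R), |q t x - c - p₁ x| ≤ B / R ^ 2) := by
    intro t
    by_cases ht : t ∈ Ioo T 0
    · obtain ⟨c, p₁, h⟩ := hwin t ht a R hR
      exact ⟨c, p₁, fun _ => h⟩
    · exact ⟨0, fun _ => 0, fun h => absurd h ht⟩
  choose c p₁ hcp using hch
  refine ⟨c, ?_⟩
  -- the slice bound on the window
  have hslice : ∀ t ∈ Ioo T 0, (∫⁻ x in ball a R, ENNReal.ofReal (Real.sqrt |q t x - c t| ^ 3)) ≤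
      ENNReal.ofReal (α * (R * Real.sqrt R / (Real.sqrt (-t) * Real.sqrt (Real.sqrt (-t)))) + β) := by
    intro t ht
    obtain ⟨hp₁c, hL2, hr⟩ := hcp t ht
    have h := slice_threeHalves_le hp₁c ht.2 hR hB hL2 hr
    refine h.trans (le_of_eq ?_)
    congr 1
    rw [hα, hβ, hV₁]; ring
  -- the bound on a window `(t₀ − R², t₁)`, `t₁ < 0`, `t₁ ≤ t₀`
  have hw : ∀ t₁ : ℝ, t₁ < 0 → t₁ ≤ t₀ →
      (∫⁻ t in Ioo (t₀ - R ^ 2) t₁, ∫⁻ x in ball a R, ENNReal.ofReal (Real.sqrt |q t x - c t| ^ 3)) ≤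
        ENNReal.ofReal ((4 * α + β) * R ^ 2) := by
    intro t₁ ht₁ ht₁₀
    set s : ℝ := t₀ - R ^ 2 with hs
    rcases le_or_gt t₁ s with hle | hlt
    · rw [Ioo_eq_empty_of_le hle, Measure.restrict_empty, lintegral_zero_measure]; exact bot_le
    have hsub : Ioo s t₁ ⊆ Ioo T 0 := fun t ht => ⟨lt_of_le_of_lt hTR ht.1, ht.2.trans ht₁⟩
    -- the time weight is continuous on `[s, t₁]`
    set g : ℝ → ℝ := fun t => α * (R * Real.sqrt R / (Real.sqrt (-t) * Real.sqrt (Real.sqrt (-t)))) + β with hg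
    have hgc : ContinuousOn g (Icc s t₁) := by
      refine (continuousOn_const.mul (continuousOn_const.div
        (continuousOn_id.neg.sqrt.mul continuousOn_id.neg.sqrt.sqrt) fun t ht => ?_)).add continuousOn_const
      have hnt : 0 < -t := neg_pos.2 (lt_of_le_of_lt ht.2 ht₁)
      exact (mul_pos (Real.sqrt_pos.2 hnt) (Real.sqrt_pos.2 (Real.sqrt_pos.2 hnt))).ne'
    have hgi : IntegrableOn g (Ioo s t₁) := (hgc.integrableOn_compact isCompact_Icc).mono_set Ioo_subset_Icc_self
    have hg0 : ∀ t ∈ Ioo s t₁, 0 ≤ g t := fun t ht => by rw [hg]; positivity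
    -- the time integral of the weight
    have hI : ∫ t in s..t₁, 1 / (Real.sqrt (-t) * Real.sqrt (Real.sqrt (-t))) ≤ 4 * Real.sqrt R := by
      rw [integral_timeWeight_threeQuarter hlt ht₁]
      have h1 : Real.sqrt (Real.sqrt (-t₀)) ≤ Real.sqrt (Real.sqrt (-t₁)) :=
        Real.sqrt_le_sqrt (Real.sqrt_le_sqrt (by linarith))
      have h2 := sqrt_sqrt_sq_add_sub_le hR.le (neg_nonneg.2 ht₀)
      rw [show -s = R ^ 2 + -t₀ by rw [hs]; ring]
      linarith
    calc (∫⁻ t in Ioo s t₁, ∫⁻ x in ball a R, ENNReal.ofReal (Real.sqrt |q t x - c t| ^ 3))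
        ≤ ∫⁻ t in Ioo s t₁, ENNReal.ofReal (g t) := setLIntegral_mono' measurableSet_Ioo fun t ht => hslice t (hsub ht)
      _ = ENNReal.ofReal (∫ t in Ioo s t₁, g t) := by
          rw [ofReal_integral_eq_lintegral_ofReal hgi ((ae_restrict_iff' measurableSet_Ioo).2 (Eventually.of_forall hg0))]
      _ ≤ ENNReal.ofReal ((4 * α + β) * R ^ 2) := by
          refine ENNReal.ofReal_le_ofReal ?_
          rw [← integral_Ioc_eq_integral_Ioo, ← intervalIntegral.integral_of_le hlt.le]
          -- the weight is interval integrable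
          have hwc : ContinuousOn (fun t : ℝ => 1 / (Real.sqrt (-t) * Real.sqrt (Real.sqrt (-t)))) (uIcc s t₁) := by
            rw [uIcc_of_le hlt.le]
            refine continuousOn_const.div (continuousOn_id.neg.sqrt.mul continuousOn_id.neg.sqrt.sqrt) fun t ht => ?_
            have hnt : 0 < -t := neg_pos.2 (lt_of_le_of_lt ht.2 ht₁)
            exact (mul_pos (Real.sqrt_pos.2 hnt) (Real.sqrt_pos.2 (Real.sqrt_pos.2 hnt))).ne'
          have hwi : IntervalIntegrable (fun t : ℝ => 1 / (Real.sqrt (-t) * Real.sqrt (Real.sqrt (-t)))) volume s t₁ :=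
            hwc.intervalIntegrable
          have eg : g = fun t => (α * (R * Real.sqrt R)) * (1 / (Real.sqrt (-t) * Real.sqrt (Real.sqrt (-t)))) + β := by
            funext t; rw [hg]; ring
          rw [eg, intervalIntegral.integral_add (hwi.const_mul _) intervalIntegrable_const,
            intervalIntegral.integral_const_mul, intervalIntegral.integral_const, smul_eq_mul]
          have hlen : t₁ - s ≤ R ^ 2 := by rw [hs]; linarith
          have h3 : α * (R * Real.sqrt R) * ∫ t in s..t₁, 1 / (Real.sqrt (-t) * Real.sqrt (Real.sqrt (-t))) ≤
              α * (R * Real.sqrt R) * (4 * Real.sqrt R) := mul_le_mul_of_nonneg_left hI (by positivity)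
          have h4 : α * (R * Real.sqrt R) * (4 * Real.sqrt R) = 4 * α * R ^ 2 := by
            rw [show α * (R * Real.sqrt R) * (4 * Real.sqrt R) = 4 * α * R * (Real.sqrt R * Real.sqrt R) by ring,
              Real.mul_self_sqrt hR.le]
            ring
          have h5 : (t₁ - s) * β ≤ R ^ 2 * β := mul_le_mul_of_nonneg_right hlen hβ0
          nlinarith [h3, h4, h5]
  -- conclusion: below the apex directly, at the apex by exhaustion
  rcases lt_or_eq_of_le ht₀ with hlt | heq
  · exact hw t₀ hlt le_rfl
  · subst heq
    have hU : Ioo (0 - R ^ 2) (0 : ℝ) = ⋃ n : ℕ, Ioo (0 - R ^ 2) (-((n : ℝ) + 1)⁻¹) := by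
      ext t
      simp only [mem_iUnion, mem_Ioo]
      constructor
      · rintro ⟨h1, h2⟩
        have hnt : 0 < -t := neg_pos.2 h2
        obtain ⟨n, hn⟩ := exists_nat_gt (1 / (-t))
        refine ⟨n, h1, ?_⟩
        have : ((n : ℝ) + 1)⁻¹ < -t := by
          rw [inv_lt_comm₀ (by positivity) hnt, inv_eq_one_div]
          linarith
        linarith
      · rintro ⟨n, h1, h2⟩
        exact ⟨h1, h2.trans (by rw [neg_lt_zero]; positivity)⟩
    have hdir : Directed (· ⊆ ·) fun n : ℕ => Ioo (0 - R ^ 2) (-((n : ℝ) + 1)⁻¹) := by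
      refine Monotone.directed_le fun m n hmn => Ioo_subset_Ioo_right ?_
      have : ((n : ℝ) + 1)⁻¹ ≤ ((m : ℝ) + 1)⁻¹ := by
        apply inv_anti₀ (by positivity)
        exact_mod_cast Nat.succ_le_succ hmn
      linarith
    rw [hU, setLIntegral_iUnion_of_directed _ hdir]
    exact iSup_le fun n => hw _ (by rw [neg_lt_zero]; positivity) (by rw [neg_nonpos]; positivity)

end Summit.NavierStokesRegularity.NavierStokesRegularity.Theorems.PoloidalWindowDoorPoloidalWindowRigiditySparseEnergyScaledPressureD

end
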